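import Summits.PneNP.PneNP.Theorems.PlantedCliquePlantedcliqueLowDegreeNormOneCharMean

/-!
# Route PlantedClique — `PlantedcliqueLowDegreeNormOne` (stmt-PneNP-8685)

The low-degree likelihood ratio of the FIXED-SIZE planted-clique model tends to `1` in the whole window
`k(n) ≤ n^{1/2-ε}` at degree `D = ⌈(log n)^{3/2}⌉` (`δ = 1/2`): by part 1,
`1 ≤ ‖L^{≤D}‖² ≤ Σ_t C(n,t) cnt(t,D) ((κ/n)²)^t ≤ 1/(1 - n^{-ε})` once `n^ε ≥ 2`, `D ≤ K_n t` past the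
regime switch `2^t > n^ε` and `(4D²+1)^{K_n} ≤ n^ε`, with `K_n = ⌈D log 2/(ε log n)⌉ = O(√log n / ε)`;
the last condition is `K_n log(4D²+1) = O(√log n · log log n) = o(log n)`.
-/

set_option linter.dupNamespace false -- `Summit.PneNP.PneNP.…`: summit = sub-problem name (D-0017 single-conjunct layout)

noncomputable section

namespace Summit.PneNP.PneNP.Theorems

open Finset Filter Asymptotics Topology
open Literature.Probability.RandomGraphs Literature.Probability.RandomGraphs.PlantedClique
  Literature.Probability.RandomGraphs.LowDegree

/-- The analytic core of the degree budget: `(c √L + 1)(log 17 + 3 log L) ≤ ε' L` for all large `L`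
(`√L · log L = o(L)`). [folklore] -/
theorem plantedcliqueLowDegree_eventually_budget (c ε' : ℝ) (hε' : 0 < ε') :
    ∀ᶠ L : ℝ in atTop, (c * L ^ (1 / 2 : ℝ) + 1) * (Real.log 17 + 3 * Real.log L) ≤ ε' * L := by
  -- `S = L^{1/2} → ∞`
  have hS : Tendsto (fun L : ℝ => L ^ (1 / 2 : ℝ)) atTop atTop := tendsto_rpow_atTop (by norm_num)
  have hone : (fun _ : ℝ => (1 : ℝ)) =o[atTop] fun L : ℝ => L ^ (1 / 2 : ℝ) :=
    (isLittleO_one_left_iff ℝ).2 (tendsto_norm_atTop_atTop.comp hS)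
  have hlog : Real.log =o[atTop] fun L : ℝ => L ^ (1 / 2 : ℝ) := isLittleO_log_rpow_atTop (by norm_num)
  have h1 : (fun L : ℝ => c * L ^ (1 / 2 : ℝ) + 1) =O[atTop] fun L : ℝ => L ^ (1 / 2 : ℝ) :=
    ((isBigO_refl _ _).const_mul_left c).add hone.isBigO
  have h2 : (fun L : ℝ => Real.log 17 + 3 * Real.log L) =o[atTop] fun L : ℝ => L ^ (1 / 2 : ℝ) := by
    refine IsLittleO.add ?_ (hlog.const_mul_left 3)
    simpa using hone.const_mul_left (Real.log 17)
  have h3 := h1.mul_isLittleO h2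
  have h4 : (fun L : ℝ => L ^ (1 / 2 : ℝ) * L ^ (1 / 2 : ℝ)) =ᶠ[atTop] fun L : ℝ => L := by
    filter_upwards [eventually_gt_atTop 0] with L hL
    rw [← Real.rpow_add hL]
    norm_num
  have h5 := (h3.congr' EventuallyEq.rfl h4).def hε'
  filter_upwards [h5, eventually_ge_atTop 0] with L hL hL0
  rw [Real.norm_of_nonneg hL0] at hL
  exact (le_abs_self _).trans ((Real.norm_eq_abs _).symm.le.trans hL)

/-- **stmt-PneNP-8685** `PlantedcliqueLowDegreeNormOne`: for every clique-size sequence with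
`k(n) ≤ n^{1/2-ε}` eventually (`ε > 0`), the squared `⌈(log n)^{3/2}⌉`-low-degree likelihood ratio of
the fixed-size planted-clique distribution against `G(n,1/2)` tends to `1`. Port of Hopkins' Lemma 2.4.1
(Bernoulli planting, degree `C log n`) to the uniform `κ`-subset planting and degree `(log n)^{1+δ}`,
`δ = 1/2`. [cite: Hopkins2018, Lemma 2.4.1] -/
theorem plantedClique_plantedcliqueLowDegreeNormOne_proof :
    Summit.PneNP.PneNP.Theses.PlantedClique.PlantedcliqueLowDegreeNormOne := by
  unfold Summit.PneNP.PneNP.Theses.PlantedClique.PlantedcliqueLowDegreeNormOne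
  rintro k ⟨ε, hε, hk⟩
  refine ⟨1 / 2, by norm_num, ?_⟩
  -- the two squeezing sequences
  have hz : Tendsto (fun n : ℕ => (n : ℝ) ^ ε) atTop atTop :=
    (tendsto_rpow_atTop hε).comp tendsto_natCast_atTop_atTop
  have hy : Tendsto (fun n : ℕ => ((n : ℝ) ^ ε)⁻¹) atTop (𝓝 0) := hz.inv_tendsto_atTop
  have hu : Tendsto (fun n : ℕ => 1 / (1 - ((n : ℝ) ^ ε)⁻¹)) atTop (𝓝 1) := by
    have h1 : Tendsto (fun n : ℕ => 1 - ((n : ℝ) ^ ε)⁻¹) atTop (𝓝 (1 - 0)) := tendsto_const_nhds.sub hy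
    rw [sub_zero] at h1
    have h2 := h1.inv₀ one_ne_zero
    rw [inv_one] at h2
    simpa only [one_div] using h2
  have hL : Tendsto (fun n : ℕ => Real.log (n : ℝ)) atTop atTop :=
    Real.tendsto_log_atTop.comp tendsto_natCast_atTop_atTop
  set c : ℝ := 2 * Real.log 2 / ε with hc
  have hbudget := hL.eventually (plantedcliqueLowDegree_eventually_budget c ε hε)
  refine tendsto_of_tendsto_of_tendsto_of_le_of_le' tendsto_const_nhds hu
    (Eventually.of_forall fun n => one_le_lowDegreeLRSq _ _) ?_
  filter_upwards [hk, hz.eventually_ge_atTop 2, hL.eventually_ge_atTop 1, hbudget, eventually_ge_atTop 1]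
    with n hkn hz2 hL1 hbn hn
  -- notation for this `n`
  have hn0 : (0 : ℝ) < n := by exact_mod_cast hn
  set L : ℝ := Real.log (n : ℝ) with hLdef
  have hL0 : 0 < L := by linarith
  set S : ℝ := L ^ (1 / 2 : ℝ) with hSdef
  have hS1 : 1 ≤ S := Real.one_le_rpow hL1 (by norm_num)
  have hSS : S * S = L := by rw [hSdef, ← Real.rpow_add hL0]; norm_num
  have hLS : L ^ (1 + 1 / 2 : ℝ) = L * S := by rw [Real.rpow_add hL0, Real.rpow_one]
  set D : ℕ := ⌈Real.log (n : ℝ) ^ (1 + 1 / 2 : ℝ)⌉₊ with hDdef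
  have hD : (D : ℝ) ≤ 2 * L * S := by
    have h1 : (D : ℝ) < L * S + 1 := by
      rw [hDdef, ← hLdef, hLS]
      exact Nat.ceil_lt_add_one (by positivity)
    have h2 : 1 ≤ L * S := by nlinarith
    linarith
  set K : ℕ := ⌈(D : ℝ) * Real.log 2 / (ε * L)⌉₊ with hKdef
  have hlog2 : 0 < Real.log 2 := Real.log_pos one_lt_two
  have hK : (K : ℝ) ≤ c * S + 1 := by
    have h1 : (K : ℝ) < (D : ℝ) * Real.log 2 / (ε * L) + 1 := Nat.ceil_lt_add_one (by positivity)
    have h2 : (D : ℝ) * Real.log 2 / (ε * L) ≤ c * S := by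
      rw [div_le_iff₀ (by positivity), hc]
      calc (D : ℝ) * Real.log 2 ≤ 2 * L * S * Real.log 2 := by gcongr
        _ = 2 * Real.log 2 / ε * S * (ε * L) := by field_simp
    linarith
  have hκ : ((min (k n) n : ℕ) : ℝ) ≤ (n : ℝ) ^ (1 / 2 - ε) :=
    le_trans (by exact_mod_cast min_le_left _ _) hkn
  refine (plantedcliqueLowDegree_lowDegreeLRSq_le n (k n) D).trans
    (plantedcliqueLowDegree_sum_le n (min (k n) n) D K ε _ hn rfl hz2 hκ (fun t ht => ?_) ?_)
  · -- past the regime switch `2^t > n^ε`: `ε L < t log 2`, so `D ≤ K t`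
    have h1 : ε * L < t * Real.log 2 := by
      rw [hLdef, ← Real.log_rpow hn0, ← Real.log_pow]
      exact Real.log_lt_log (Real.rpow_pos_of_pos hn0 ε) ht
    have h2 : (D : ℝ) * Real.log 2 ≤ K * (ε * L) := by
      rw [← div_le_iff₀ (by positivity)]
      exact Nat.le_ceil _
    have h3 : (D : ℝ) * Real.log 2 ≤ (K * t) * Real.log 2 := by
      calc (D : ℝ) * Real.log 2 ≤ K * (ε * L) := h2
        _ ≤ K * (t * Real.log 2) := by gcongr
        _ = (K * t) * Real.log 2 := by ring
    have h4 : (D : ℝ) ≤ K * t := le_of_mul_le_mul_right h3 hlog2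
    exact_mod_cast h4
  · -- the degree budget: `K log(4D²+1) ≤ (c S + 1)(log 17 + 3 log L) ≤ ε L = log n^ε`
    have hpos : (0 : ℝ) < 4 * (D : ℝ) ^ 2 + 1 := by positivity
    have h4D : 4 * (D : ℝ) ^ 2 + 1 ≤ 17 * L ^ 3 := by
      have h1 : (D : ℝ) ^ 2 ≤ (2 * L * S) ^ 2 := pow_le_pow_left₀ (Nat.cast_nonneg _) hD 2
      have h2 : (2 * L * S) ^ 2 = 4 * L ^ 3 := by
        calc (2 * L * S) ^ 2 = 4 * L ^ 2 * (S * S) := by ring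
          _ = 4 * L ^ 3 := by rw [hSS]; ring
      have h3 : 1 ≤ L ^ 3 := one_le_pow₀ hL1
      nlinarith
    have hlogle : Real.log (4 * (D : ℝ) ^ 2 + 1) ≤ Real.log 17 + 3 * Real.log L := by
      calc Real.log (4 * (D : ℝ) ^ 2 + 1) ≤ Real.log (17 * L ^ 3) := Real.log_le_log hpos h4D
        _ = Real.log 17 + 3 * Real.log L := by
          rw [Real.log_mul (by norm_num) (by positivity), Real.log_pow]
          norm_num
    have hlog0 : 0 ≤ Real.log (4 * (D : ℝ) ^ 2 + 1) := Real.log_nonneg (by nlinarith)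
    have hkey : (K : ℝ) * Real.log (4 * (D : ℝ) ^ 2 + 1) ≤ ε * L :=
      calc (K : ℝ) * Real.log (4 * (D : ℝ) ^ 2 + 1)
          ≤ (c * S + 1) * (Real.log 17 + 3 * Real.log L) := mul_le_mul hK hlogle hlog0 (by positivity)
        _ ≤ ε * L := hbn
    rw [← Real.log_le_log_iff (pow_pos hpos K) (Real.rpow_pos_of_pos hn0 ε), Real.log_pow,
      Real.log_rpow hn0]
    exact hkey

end Summit.PneNP.PneNP.Theorems

end
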